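import Summits.Ventures.PercRepro.RankLevelSetBiIndepAbsorbStar
import Summits.Ventures.PercRepro.RankLevelSetBiIndepAbsorbTruncate
import Summits.Ventures.PercRepro.RankLevelSetBiIndepAbsorbParallel

/-! # RankLevelSetBiIndepAbsorbStarClosure — (ABS-star) SURVIVES TRUNCATION, AND PARALLEL EXTENSION GIVEN MONO OF THE
MINOR: THE (ABS-star) CLASS CONTAINS THE CLOSURE OF THE PAVING MATROIDS UNDER TRUNCATION AND PARALLEL EXTENSION
(night-1 g33; dossier §45.10 (f))

TRUNCATION (**`absorbStar_truncateTo`**): the absorbing profile of `T_k M` is the window `j ≤ k ∧ #E − j ≤ k` of that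
of `M` (g32), and the top of the window never meets the range `2j + 1 ≤ #E` of a star step (`j = k ≥ #E − k` would
give `2j ≥ #E`), so every non-vacuous step is a step of `M`. PARALLEL EXTENSION (**`absorbStar_of_parallel`**): for a
parallel pair `{y, z}` and `N = M ／ {y} ＼ {z}` on `#E − 2` elements, g32's identities `A^x_{j+1}(M) = 2·A^x_j(N)`
(`x ∉ {y, z}`) and `A^y_{j+1}(M) = A^z_{j+1}(M) = D_j(N)` turn the star step of `M` at level `k` into the star step of
`N` at level `k − 1` plus `A^x_{k−1}(N) ≤ A^x_k(N)` (both from (ABS-star) of `N`), and at the pair itself into the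
monotone form `(#E(N) − (k − 1))·D_{k−1}(N) ≤ k·D_k(N)`, i.e. Mono of `N` — exactly the hypotheses of g32's
`absorbNormSkew_of_parallel`. Every paving matroid satisfies (ABS-star) and Mono (g33, g25), so the class is
closed as stated. Every declaration has a docstring; imports: the cell's own modules and Mathlib only. Axioms:
standard. -/

namespace PercRepro

open Set Matroid

variable {α : Type} (M : Matroid α) [M.Finite]

/-- **(ABS-star) SURVIVES TRUNCATION**: `BiIndepAbsorbStar M → BiIndepAbsorbStar (T_k M)`. -/
theorem absorbStar_truncateTo (h : BiIndepAbsorbStar M) (k : ℕ) :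
    haveI := truncateTo_finite M k
    BiIndepAbsorbStar (truncateTo M k) := by
  haveI := truncateTo_finite M k
  intro x hx j hj
  rw [truncateTo_E] at hx hj ⊢
  by_cases hA : lowAbsorbCount (truncateTo M k) x j = 0
  · rw [hA, Nat.mul_zero]; exact Nat.zero_le _
  · have hwin : j ≤ k ∧ M.E.ncard - j ≤ k := by
      by_contra hcon
      apply hA
      unfold lowAbsorbCount
      rw [lowAbsorbAt_truncateTo_eq_empty M x hcon, Set.ncard_empty]
    -- the top of the window is out of range: `j < k`
    have hjk : j + 1 ≤ k := by omega
    have hAj : lowAbsorbCount (truncateTo M k) x j = lowAbsorbCount M x j := by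
      unfold lowAbsorbCount
      rw [lowAbsorbAt_truncateTo_of_lt M x hjk hwin.2]
    have hM := h x hx j hj
    rw [hAj]
    rcases Nat.lt_or_ge (j + 1) k with hlt | hge
    · have hAj1 : lowAbsorbCount (truncateTo M k) x (j + 1) = lowAbsorbCount M x (j + 1) := by
        unfold lowAbsorbCount
        rw [lowAbsorbAt_truncateTo_of_lt M x (by omega) (by omega)]
      rw [hAj1]; exact hM
    · have hk : j + 1 = k := by omega
      have hle : lowAbsorbCount M x (j + 1) ≤ lowAbsorbCount (truncateTo M k) x (j + 1) := by
        unfold lowAbsorbCount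
        rw [hk]
        exact Set.ncard_le_ncard (lowAbsorbAt_subset_truncateTo M x (by omega)) (lowAbsorbAt_finite _ x k)
      exact hM.trans (Nat.mul_le_mul_left _ hle)

/-- **The monotone step of the minor, up to the middle**: for `N = M ／ {y} ＼ {z}` on `m = #E − 2` elements with
Mono, `(m − j) · D_j(N) ≤ (j + 1) · D_{j+1}(N)` whenever `2(j + 1) + 1 ≤ #E`, i.e. `2j + 1 ≤ m`: below the middle
by Mono, at the middle `m = 2j + 1` by the symmetry `D_j = D_{m−j} = D_{j+1}`. -/
lemma mono_step {y z : α} (h : ParallelPair M y z) (hNm : BiIndepMono ((M.contract {y}).delete {z})) (j : ℕ)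
    (hk : 2 * (j + 1) + 1 ≤ M.E.ncard) :
    (M.E.ncard - 2 - j) * biIndepCount ((M.contract {y}).delete {z}) j ≤
      (j + 1) * biIndepCount ((M.contract {y}).delete {z}) (j + 1) := by
  haveI : ((M.contract {y}).delete {z}).Finite :=
    ⟨M.ground_finite.subset (by rw [ground_contract_delete]; exact Set.sdiff_subset)⟩
  have hcard := ncard_ground_contract_delete M h
  rcases Nat.lt_or_ge (2 * j + 1) (M.E.ncard - 2) with hlt | hge
  · have := hNm j (by rw [hcard]; exact hlt)
    rwa [hcard] at this
  · -- the middle: `#E − 2 = 2j + 1`, `D_j = D_{j+1}` by symmetry, and `#E − 2 − j = j + 1`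
    have hm : M.E.ncard - 2 = 2 * j + 1 := by omega
    have hsym := biIndepCount_compl ((M.contract {y}).delete {z}) j (by rw [hcard]; omega)
    rw [hcard, hm, show 2 * j + 1 - j = j + 1 by omega] at hsym
    rw [hm, show 2 * j + 1 - j = j + 1 by omega, ← hsym]

/-- **(ABS-star) IS CLOSED UNDER PARALLEL EXTENSION GIVEN MONO OF THE MINOR**: for a parallel pair `{y, z}` and
`N = M ／ {y} ＼ {z}`, (ABS-star) of `N` and Mono of `N` give (ABS-star) of `M`. -/
theorem absorbStar_of_parallel {y z : α} (h : ParallelPair M y z)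
    (hN : BiIndepAbsorbStar ((M.contract {y}).delete {z}))
    (hNm : BiIndepMono ((M.contract {y}).delete {z})) : BiIndepAbsorbStar M := by
  haveI : ((M.contract {y}).delete {z}).Finite :=
    ⟨M.ground_finite.subset (by rw [ground_contract_delete]; exact Set.sdiff_subset)⟩
  have hcard := ncard_ground_contract_delete M h
  have hn2 : 2 ≤ M.E.ncard := by
    have := Set.ncard_le_ncard (Set.pair_subset h.2.1.mem_ground h.2.2.1.mem_ground) M.ground_finite
    rwa [Set.ncard_pair h.1] at this
  intro x hx k hk
  cases k with
  | zero =>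
    rw [lowAbsorbCount_zero_of_parallel M h x, Nat.mul_zero]; exact Nat.zero_le _
  | succ j =>
    -- the step at level `j + 1` of `M`
    by_cases hxy : x = y
    · subst hxy
      rw [lowAbsorbCount_succ_of_parallel_left M h j, lowAbsorbCount_succ_of_parallel_left M h (j + 1)]
      have hc : M.E.ncard - 1 - (j + 1) = M.E.ncard - 2 - j := by omega
      rw [hc]
      exact mono_step M h hNm j hk
    by_cases hxz : x = z
    · subst hxz
      rw [lowAbsorbCount_succ_of_parallel_right M h j, lowAbsorbCount_succ_of_parallel_right M h (j + 1)]
      have hc : M.E.ncard - 1 - (j + 1) = M.E.ncard - 2 - j := by omega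
      rw [hc]
      exact mono_step M h hNm j hk
    · have hxN : x ∈ ((M.contract {y}).delete {z}).E := by
        rw [ground_contract_delete]
        exact ⟨hx, by simp only [Set.mem_insert_iff, Set.mem_singleton_iff, not_or]; exact ⟨hxy, hxz⟩⟩
      rw [lowAbsorbCount_succ_of_parallel M h hxy hxz j, lowAbsorbCount_succ_of_parallel M h hxy hxz (j + 1)]
      -- (ABS-star) of `N` at level `j`, and `A_j(N) ≤ A_{j+1}(N)`
      have hstar := hN x hxN j (by rw [hcard]; omega)
      have hle := lowAbsorbCount_le_succ _ hN hxN (k := j) (by rw [hcard]; omega)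
      rw [hcard] at hstar
      have hc : M.E.ncard - 1 - (j + 1) = (M.E.ncard - 2 - 1 - j) + 1 := by omega
      rw [hc]
      calc ((M.E.ncard - 2 - 1 - j) + 1) * (2 * lowAbsorbCount ((M.contract {y}).delete {z}) x j)
          = 2 * ((M.E.ncard - 2 - 1 - j) * lowAbsorbCount ((M.contract {y}).delete {z}) x j) +
              2 * lowAbsorbCount ((M.contract {y}).delete {z}) x j := by ring
        _ ≤ 2 * (j * lowAbsorbCount ((M.contract {y}).delete {z}) x (j + 1)) +
              2 * lowAbsorbCount ((M.contract {y}).delete {z}) x (j + 1) :=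
            Nat.add_le_add (Nat.mul_le_mul_left _ hstar) (Nat.mul_le_mul_left _ hle)
        _ = (j + 1) * (2 * lowAbsorbCount ((M.contract {y}).delete {z}) x (j + 1)) := by ring

end PercRepro
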